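import Literature.MathematicalPhysics.QuantumFieldTheory.Balaban1983to89.Node00.Record11
import Literature.MathematicalPhysics.QuantumFieldTheory.Balaban1983to89.B12Lemma4ConcreteFrame

/-!
# NODE 00 (YM-PLAN Track A) — STAGE 3′(X.B12) OF THE CARRIERS OF RECORD: the [Balaban1987RG1] §§2–5 group of `X` (the frame and constants of LEMMA 4
# (3.53) p. 280) PINNED, AT STAGE 11, to THE RECORD'S OWN (I.1.11)–(1.16) frames `Sect2.frameI (θ.Rz p.K) θ.τ9.M …` of def-T's 11b, the `SU(N)` model of record,
# the projection `π` of (1.8), the scales `ξ = L⁻ʲ`, `η = L⁻ᵏ`, print's regions `□₀ = □̃⁵`, `Y = □̃³` and an instance index `(k, j, □, X)`; the [15]-letters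
# `𝐊 = 𝐇_j(□₀, τQ(L⁻¹η𝐇_{k+1}(□₀, (1/i) log V)))`, `𝐀₂` of (3.50), the class (3.31) and the constants carried as ONE explicit residual datum `ResidB12Run`; the
# `b12` leaf at the group of record; lit-balaban p07's `lemma4Printed_frameOf` AS THE KNIT FACE (the pin and the record predicate: sequel `Node00/Record11CarriersB12`)

NODE 00 CARRIER MODULE, sixth pin (seat `pub-ymgap-node00-def` g32, 2026-08-26; director-ym R134 (c) trigger t1; design `HOME/pub-ymgap-node00-def/STAGE10-CARRIERS-DESIGN-g29.md`
§2 row «X.B12» + `…-g31.md` §0′; dag-lead FAN-OUT v1.1 §N09 («the missing piece is NODE 00 NAMING the package»)).  APPEND-ONLY: a NEW importing module; def-T's `Record11`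
(hence 11b `Sect2FrameOfRecord`, `Record10`, the carrier modules below it) and the lit-balaban lineage's `B12Lemma4ConcreteFrame` (p07),
`B12Lemma4Models` ∕ `B12Eq311Models` (r20), `B12RegularSpaces111SpecialUnitary` (pub-balaban) untouched and CONSUMED BY NAME.
[Balaban1987RG1] = T. Bałaban, *Renormalization group approach to lattice gauge field theories. I*, Commun. Math. Phys. **109** (1987) 249–301 (cell paper B12 = [I]);
[15] = [Balaban1985Variational], Commun. Math. Phys. **102** (1985) 277–309.

WHY AT STAGE 11 (and not on `Stage3Params` like the [B8] pin).  Lemma 4's spaces `U′ᶜ_{k+1}(□₀, ·)` and `Uᶜ_j(X, ·)` are [I] (1.11)–(1.16) spaces — EXACTLY the spaces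
def-T's Stage-11 record reads for the §2 [III] form (`Sect2.spaceI` on `Sect2.frameI (θ.Rz p.K) θ.τ9.M j Y`, proviso `bg` p. 259).  Pinning Lemma 4 to those SAME frames
(same residual background functions `Rz.bgI` of (1.15), same cube size `M`, same `O(1)LMB`, same model `suModel N`) makes the leaf speak about the record's own spaces; a
Stage-3-keyed pin would have carried a second, unrelated copy of the (1.15) recipes.

WHAT IS PINNED (per run `p`, torus `F.P p.K`, fine lattice `T_ε` = level `0`).  In `Residual₅.X p : PrintedCarriersR` the [B12 §§2–5] group (`F12 : B12Sec2to5.Lemma4Frame`,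
`c12 : B12Sec2to5.Lemma4Consts`) was free data at every record predicate so far (the Stage-1–3 substitutions do not touch it: `CarriersFrame.carriers₁_groupB12`; the view
`residualOfStage11` keeps `X`).  At a [B12]-pinned parameter `θ.pinB12 lam` that group IS (`F12OfRecord ∕ ResidB12Run.consts`): carriers `CfgU = CfgUJ = FieldPair (F.P p.K) 0
(M_N(ℂ))ˣ M_N(ℂ)` (pairs `(𝐔, 𝐉)`), `CfgA = CfgB` = bond functions; `Uprime a₀ a₁ = U′ᶜ_{k+1}(□₀, a₀, a₁, α₀)` := `B12RegularSpaces111.space (suModel N)` on THE FRAME OF RECORD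
`Sect2.frameI (θ.Rz p.K) θ.τ9.M (k+1) □̃⁵` with `StepConsts.ofParams _ θ.s2.cB (k+1)` (print p. 277 «on the space U′ᶜ_{k+1}(□₀,(1+2β)α₀,(1+2β)α₁,α₀)»: `γ₀′ := α₀` PINNED);
`Ucj a₀ a₁ = Uᶜ_j(X, a₀, a₁)` := `space'` on `Sect2.frameI (θ.Rz p.K) θ.τ9.M j X`; `comp 𝐔 𝐀 τ B′ = (V, J(V))`, `V = exp iξ(𝐊 + 𝐀₂)` with the current (1.8) at `π := slProj N`
(`B12Eq18Current.ofBackground`); `analyticOn` = the lattice reading of «analytic on the above spaces» (p07's `LettersAnalyticAt`, verbatim); `|B′| := ‖B′‖` (sup over the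
bonds of `T_ε`; print: over the bonds where `B′` is defined — a located reading, same supremum for functions extended by `0`); constants `c12 := ⟨B₃, O(1), M := θ.τ9.M,
L := F.L, β₀, β, α₀, α₁, α₂, α₃⟩`.  THE INSTANCE INDEX `IdxB12` = `(k, j, 1 ≤ j ≤ k, □ ∈ π_{k+1}, X ∈ 𝐃_j)` over 11b's torus catalogue (`Sect2.domSys`, `Sect2.cubeDom`,
`Sect2.domSites`); `□̃ⁿ := Sect2.enlT _ (side L M (k+1)) n □`; `η := L⁻ᵏ` (`Params.eta`).  The DAG leaf `b12` reads ONE frame per run (its typing in `DagBinding`); print's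
Lemma 4 is the family over `(k, j, □, X)` — the ∀-form over the residual below covers it (SAID).

WHAT STAYS RESIDUAL, EXPLICITLY (`ResidB12Run`, data, no law; quantified with the record's parameters): the instance index; the two [15]-letters `𝐊 : (𝐔, 𝐀, τ) ↦ 𝐇_j(□₀,
τQ(L⁻¹η𝐇_{k+1}(□₀, (1/i) log V(𝐔))))` ((3.26)–(3.30), (3.37)) and `𝐀₂ : (𝐔, 𝐀, τ, B′) ↦ 𝐀₂` ((3.50)) — print builds them from [15]'s Landau-gauge chart 𝓗 (174) p. 305 of the
minimisers: NO tree object (11b's `Sect2.Residual.bgI` is residual for the same reason; seat n09-b's `B12Lemma4ChartSizes` derives their SIZES (3.37)∕(3.45)∕(3.50) for the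
ABSTRACT chart `B11Eq174Chart.chartH` on a presentation — a consumer instantiates `lam.K := ev ∘ chartH …` and cites those; a name-level pin of the chart is a successor);
the class (3.31) of the fields `𝐀` on `□₀` (`|𝐀|, |∇^η𝐀|, ‖𝐀‖_{1,β} < α₂` — the Hölder seminorm of [15] Sect. F has no tree object); the constants `B₃` ([15] Prop. 9), `O(1)`,
`β₀, β, α₀, …, α₃` and `B₃″` of (J3).  JUNK ANALYSIS (R433 species, SAID): at a record the spaces are non-empty (`Provisos₁₁.rzLaws` ⇒ the unit pair lies in every
`U′ᶜ`∕`Uᶜ` of record, def-T's `one_mem_spaceI_stage11`), so the leaf's `∀ 𝐔 ∈ U′ᶜ_{k+1}(□₀, …)` is exercised; junk letters `𝐊 = 𝐀₂ = 0` make the leaf TRUE (lit-balaban r20's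
`trivInputs` shape) and wild letters make it FALSE — the leaf is a genuine statement about the residual data, closable over the record class only through the companion's displayed
by-reference package, never by bookkeeping; an EMPTY (3.31) class makes that package's `JInputs` clause vacuous — consumers wanting content display `0 ∈ lam.A331` (print p. 277
«At first let us take 𝐀 = 0»).

THE KNIT FACE = p07's `lemma4Printed_frameOf` BY NAME — typed in the COMPANION module of seat `pub-ymgap-node00-def-B12` (director-ym LINE №72 (3), 2026-08-26: one pen per
file): a DISPLAYED by-reference package (p07's `Lemma4Data` law-fields that are not theorems for the objects of record — the seven further restrictions on the constants,
the seven region inclusions of print's fundamental case `X ⊂ □̃² ⊂ Y = □̃³ ⊂ (□̃⁵)^{∼−2}`, THE `JInputs` PACKAGE for every value of the variables in the printed domain, the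
analyticity of the letters; the scale and model ∕ projection fields being theorems: `Params.eta`, r20's `suModel_heGc`, `slProj_mem_suModel_gc`, `suModel_hgc_Gc`, `slProj_conj`,
`B12Eq311Models.norm_slProj_le`), `lemma4DataOfRecord`, `frameOf (lemma4DataOfRecord …) = F12OfRecord …` (`rfl`) and the face «package ⇒ `B12LeafOfRecord`» — N09's conjunct 1 AT
THE GROUP OF RECORD from the displayed package, nothing else.  This module types the OBJECTS (index, residual, frames, leaf) only.

THE PIN, THE SIX-PIN VIEW AND THE RECORD PREDICATE are the sequel module `Node00/Record11CarriersB12` (an `X`-re-binding at Stage 11 through g31's generic device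
`Stage11Params.rebindX`, UP-SIDE; `IsRecordOfRecord₁₁CB10YZWB8B12 → IsRecordOfRecord₁₁CB10YZWB8` SAME datum SAME world; the `b12` leaf faces and N09's conjunct-1 slot form).
KERNEL LESSONS kept (g30∕g31): single-leaf `rfl`s only; X-pin `rfl`s at ₁₁ through `rebindX`; admissibility through the `iff` chain; ONE `DecidableEq (PBond …)` instance per
statement (none needed here).  HONEST FRAMING: definitions + kernel bookkeeping; NO estimate; nothing of [Balaban1987RG1] ∕ [15] asserted; N09 NOT discharged; counts
unmoved (5∕28); one finite T⁴ programme at fixed ε — NOT continuum ∕ ℝ⁴ ∕ infinite volume ∕ OS ∕ mass gap ∕ Clay.  No `sorry`, no `axiom`, no `opaque`, no `instance`, no `notation`. -/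

noncomputable section

namespace Literature.MathematicalPhysics.QuantumFieldTheory.Balaban1983to89.Node00

open T4Continuum AveragingRT T4FiniteEpsInhabited FlowStep FlowStepRuns DagBinding T4DatumAssembly
open B12RegularSpaces111 (Frame Region StepConsts space space' expI grad CondIV)
open B12Eq18Current (ofBackground current)
open B12Lemma4ConcreteFrame (LettersAnalyticAt)
open B12Lemma4Models (slProj)
open B12RegularSpaces111SpecialUnitary (suModel)
open Step B14DomainGeom B14.Eq213MaximalDomains B15Eq112TorusCover TreeLengthTorus
open scoped Matrix.Norms.L2Operator

/-! ## §1. The instance index, the residual layer, the frame of Lemma 4 of record and the leaf -/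

section Bundle

variable (P : Params) (N M : ℕ)

/-- **The instance index of Lemma 4 at NODE 00's objects**: the level `k` of the step (`U_{k+1}(□₀, ·)`, frame `F′` at scale `k+1`), the level `j` of the localization
domain with `1 ≤ j ≤ k` (p. 279 «Let us notice that j ≤ k»; (3.34) is at `U_j(□₀, 1)`, `j ≥ 1`), the cube `□ ∈ π_{k+1}` (an `M`-cube of `T^{(k+1)}`, 11b's torus index) whose
enlargements are `□₀ = □̃⁵`, `Y = □̃³`, and the localization domain `X ∈ 𝐃_j` (11b's `Sect2.domSys`; print's fundamental case `X ⊂ □̃²` is a DISPLAYED law of the companion's package).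
[cite: Balaban1987RG1, p.275 («the fundamental case X ⊂ □̃²», «□₀ = □̃⁵»), p.279 («j ≤ k»), Lemma 4 p.280] -/
structure IdxB12 where
  /-- the step `k` -/
  k : ℕ
  /-- the level `j` of `X ∈ 𝐃_j` -/
  j : ℕ
  one_le_j : 1 ≤ j
  j_le_k : j ≤ k
  /-- the cube `□ ∈ π_{k+1}` -/
  cube : TPt P.d (Sect2.domCount P M (k + 1))
  /-- the localization domain `X ∈ 𝐃_j` -/
  X : (Sect2.domSys P M j).Dom

namespace IdxB12

variable {P M}

/-- `□` as a set of fine sites. [cite: Balaban1987RG1, p.257 (the cubes), p.275] -/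
def cubeSites (i : IdxB12 P M) : Set (Site P 0) :=
  Sect2.domSites P M (i.k + 1) (Sect2.cubeDom P M (i.k + 1) i.cube)

/-- `□̃ⁿ` = `□` with `n` layers of `π_{k+1}`-cubes added (11b's `Sect2.enlT`). [cite: Balaban1987RG1, p.275 («□̃²», «□̃⁵»); Balaban1988Convergent, (2.1)–(2.3) pp.254–255] -/
def boxT (i : IdxB12 P M) (n : ℕ) : Set (Site P 0) :=
  Sect2.enlT P (side P.L M (i.k + 1)) n i.cubeSites

/-- `X` as a set of fine sites (the union of its `M`-cubes of `T^{(j)}`). [cite: Balaban1987RG1, p.257] -/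
def XSites (i : IdxB12 P M) : Set (Site P 0) :=
  Sect2.domSites P M i.j i.X

/-- `η = L⁻ᵏ`. [cite: Balaban1987RG1, (1.2) p.260, p.275] -/
def η (i : IdxB12 P M) : ℝ := P.eta i.k

end IdxB12

/-- **THE RESIDUAL LAYER of the [B12 §§2–5] group at NODE 00's objects, for ONE run** (data, no law): the instance index; the [15]-letters `𝐊 : ((𝐔, 𝐉), 𝐀, τ) ↦
𝐇_j(□₀, τQ(L⁻¹η𝐇_{k+1}(□₀, (1/i) log V(𝐔))))` ((3.26)–(3.30), (3.37)) and `𝐀₂ : ((𝐔, 𝐉), 𝐀, τ, B′) ↦ 𝐀₂` ((3.50)) — no tree object (print: composites of [15]'s chart (174));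
the class (3.31) of the fields `𝐀` on `□₀`; the constants `B₃` ([15] Prop. 9), `O(1)`, `β₀, β` (Hölder data of (3.28)∕(3.31)), `α₀, α₁, α₂, α₃` of Lemma 4 and `B₃″` of (J3).
[cite: Balaban1987RG1, (3.26)–(3.31) pp.275–276, (3.37) p.277, (3.50) p.280, Lemma 4 p.280] -/
structure ResidB12Run where
  /-- the instance `(k, j, □, X)` -/
  idx : IdxB12 P M
  /-- `𝐊 = 𝐇_j(□₀, τQ(L⁻¹η𝐇_{k+1}(□₀, (1/i) log V(𝐔))))` -/
  K : FieldPair P 0 (MatA N)ˣ (MatA N) → (PBond P 0 → MatA N) → ℝ → PBond P 0 → MatA N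
  /-- `𝐀₂` of (3.50) -/
  A₂ : FieldPair P 0 (MatA N)ˣ (MatA N) → (PBond P 0 → MatA N) → ℝ → (PBond P 0 → MatA N) → PBond P 0 → MatA N
  /-- the class (3.31) of the fields `𝐀` on `□₀` -/
  A331 : Set (PBond P 0 → MatA N)
  /-- `B₃, O(1), β₀, β, α₀, α₁, α₂, α₃` and `B₃″` -/
  (B₃ O₁ β₀ β α₀ α₁ α₂ α₃ B₃'' : ℝ)

namespace ResidB12Run

variable {P N M}

/-- **The constants of Lemma 4 of record**: the residual `B₃, O(1), β₀, β, α₀, …, α₃` with `M :=` [I]'s cube size of the record and `L :=` the torus's block size.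
[cite: Balaban1987RG1, §3 pp.277–280 («all the restrictions»)] -/
def consts (lam : ResidB12Run P N M) : B12Sec2to5.Lemma4Consts :=
  ⟨lam.B₃, lam.O₁, (M : ℝ), (P.L : ℝ), lam.β₀, lam.β, lam.α₀, lam.α₁, lam.α₂, lam.α₃⟩

/-- **The frame `F` of `Uᶜ_j(X, α₀, α₁)` OF RECORD** (11b's `Sect2.frameI` at the residual (1.15) recipes `Rz`, cube size `M`, level `j`, domain `X`).
[cite: Balaban1987RG1, (1.11)–(1.16) p.262, (3.53) p.280] -/
def frameX (Rz : Sect2.Residual P (MatA N)) (lam : ResidB12Run P N M) : Frame P 0 (MatA N) :=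
  Sect2.frameI Rz M lam.idx.j lam.idx.XSites

/-- **The frame `F′` of `U′ᶜ_{k+1}(□₀, ·)` OF RECORD**, `□₀ = □̃⁵`, level `k+1`. [cite: Balaban1987RG1, (1.11)–(1.16) p.262, p.275 («□₀ = □̃⁵»), (3.40) p.278] -/
def frameBox (Rz : Sect2.Residual P (MatA N)) (lam : ResidB12Run P N M) : Frame P 0 (MatA N) :=
  Sect2.frameI Rz M (lam.idx.k + 1) (lam.idx.boxT 5)

/-- **The region `Y = □̃³`** («on □̃³», (3.37)∕(3.40)∕(3.42)). [cite: Balaban1987RG1, (3.37) p.277, (3.40) p.278] -/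
def regionY (lam : ResidB12Run P N M) : Region P 0 :=
  Sect2.regionOfSet P (lam.idx.boxT 3)

/-- The constants of the `j`-th space of record (`ξ = L⁻ʲ`, `L`, `O(1)LMB`). [cite: Balaban1987RG1, (1.12) p.262] -/
abbrev csX (cB : ℝ) (lam : ResidB12Run P N M) : StepConsts := StepConsts.ofParams P cB lam.idx.j

/-- The constants of the `(k+1)`-st space of record (`ξ′ = L^{−(k+1)} = L⁻¹η`). [cite: Balaban1987RG1, (1.12) p.262, p.275] -/
abbrev csBox (cB : ℝ) (lam : ResidB12Run P N M) : StepConsts := StepConsts.ofParams P cB (lam.idx.k + 1)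

end ResidB12Run

variable {P N M}

/-- **THE FRAME OF LEMMA 4 OF RECORD** (`B12Sec2to5.Lemma4Frame` — the carrier the DAG leaf `b12` reads): pairs `(𝐔, 𝐉)` on `T_ε` with values in `M_N(ℂ)ˣ × M_N(ℂ)`;
`Uprime a₀ a₁ = U′ᶜ_{k+1}(□₀, a₀, a₁, α₀)` and `Ucj a₀ a₁ = Uᶜ_j(X, a₀, a₁)` = pub-balaban's unions of orbits `B12RegularSpaces111.space ∕ space'` in the `SU(N)` model ON THE FRAMES
OF RECORD; `A331` residual; `|B′| = ‖B′‖`; `comp 𝐔 𝐀 τ B′ = (V, J(V))`, `V = exp iξ(𝐊(𝐔, 𝐀, τ) + 𝐀₂(𝐔, 𝐀, τ, B′))` with the current (1.8) at `π = slProj N`; `analyticOn` = along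
every analytic family of the variables in the printed domain the pair is letter-wise analytic (p07's reading, verbatim).
[cite: Balaban1987RG1, Lemma 4 (3.53) p.280; (1.8) p.261, (1.11)–(1.16) pp.262–263, (3.31) p.276, (3.50) p.280] -/
def F12OfRecord (Rz : Sect2.Residual P (MatA N)) (cB : ℝ) (lam : ResidB12Run P N M) : B12Sec2to5.Lemma4Frame where
  CfgU := FieldPair P 0 (MatA N)ˣ (MatA N)
  CfgA := PBond P 0 → MatA N
  CfgB := PBond P 0 → MatA N
  CfgUJ := FieldPair P 0 (MatA N)ˣ (MatA N)
  Uprime a₀ a₁ := space (suModel N) (lam.frameBox Rz) (lam.csBox cB) a₀ a₁ lam.α₀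
  A331 := lam.A331
  normB B' := ‖B'‖
  Ucj a₀ a₁ := space' (suModel N) (lam.frameX Rz) (lam.csX cB) a₀ a₁
  comp Φ A τ B' := ofBackground (slProj N) (lam.csX cB).ξ (fun b => expI (lam.csX cB).ξ (lam.K Φ A τ b + lam.A₂ Φ A τ B' b))
  analyticOn a₀ a₁ a₃ := ∀ (E : Type) [NormedAddCommGroup E] [NormedSpace ℂ E] (Φf : E → FieldPair P 0 (MatA N)ˣ (MatA N))
    (Af Bf : E → PBond P 0 → MatA N) (τ : ℝ) (e₀ : E), LettersAnalyticAt Φf Af Bf e₀ →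
      Φf e₀ ∈ space (suModel N) (lam.frameBox Rz) (lam.csBox cB) a₀ a₁ lam.α₀ → Af e₀ ∈ lam.A331 → 0 ≤ τ → τ ≤ 1 → ‖Bf e₀‖ < a₃ →
        AnalyticAt ℂ (fun e : E =>
          ((fun b => ((ofBackground (slProj N) (lam.csX cB).ξ
              (fun b => expI (lam.csX cB).ξ (lam.K (Φf e) (Af e) τ b + lam.A₂ (Φf e) (Af e) τ (Bf e) b))).U b : MatA N)),
            (ofBackground (slProj N) (lam.csX cB).ξ (fun b => expI (lam.csX cB).ξ (lam.K (Φf e) (Af e) τ b + lam.A₂ (Φf e) (Af e) τ (Bf e) b))).J)) e₀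

/-- **THE `b12` LEAF AT THE GROUP OF RECORD**: LEMMA 4 (3.53) AS PRINTED (`B12Sec2to5.Lemma4Printed`: under «all the restrictions», for `𝐔 ∈ U′ᶜ_{k+1}(□₀, (1+2β)α₀, (1+2β)α₁)`,
`𝐀` in (3.31), `τ ∈ [0, 1]`, `|B′| < α₃`: `(V, J(V)) ∈ Uᶜ_j(X, α₀, α₁)`, and analyticity on these spaces) AT THE FRAME AND CONSTANTS OF RECORD.
[cite: Balaban1987RG1, Lemma 4 (3.53) p.280] -/
def B12LeafOfRecord (Rz : Sect2.Residual P (MatA N)) (cB : ℝ) (lam : ResidB12Run P N M) : Prop :=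
  B12Sec2to5.Lemma4Printed (F12OfRecord Rz cB lam) lam.consts

/-- The membership half of the leaf at the group of record, unbundled (p07's `comp_mem_Ucj` shape). [cite: Balaban1987RG1, Lemma 4 (3.53) p.280] -/
theorem comp_mem_Ucj_of_b12LeafOfRecord {Rz : Sect2.Residual P (MatA N)} {cB : ℝ} {lam : ResidB12Run P N M} (h : B12LeafOfRecord Rz cB lam)
    (hR : B12Sec2to5.Lemma4Restrictions lam.consts) {Φ : FieldPair P 0 (MatA N)ˣ (MatA N)} {A : PBond P 0 → MatA N} {τ : ℝ} {B' : PBond P 0 → MatA N}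
    (hΦ : Φ ∈ space (suModel N) (lam.frameBox Rz) (lam.csBox cB) ((1 + 2 * lam.consts.β) * lam.consts.α₀) ((1 + 2 * lam.consts.β) * lam.consts.α₁) lam.α₀)
    (hA : A ∈ lam.A331) (hτ0 : 0 ≤ τ) (hτ1 : τ ≤ 1) (hB' : ‖B'‖ < lam.consts.α₃) :
    ofBackground (slProj N) (lam.csX cB).ξ (fun b => expI (lam.csX cB).ξ (lam.K Φ A τ b + lam.A₂ Φ A τ B' b)) ∈
      space' (suModel N) (lam.frameX Rz) (lam.csX cB) lam.consts.α₀ lam.consts.α₁ :=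
  (h hR).1 Φ A τ B' hΦ hA hτ0 hτ1 hB'

/-- The residual layer's type is inhabited (DEGENERATE inhabitant: `k = j = 1`, the first cube, a single-cube domain, zero letters, the whole class, zero constants — NOT
objects of record). [cite: Balaban1987RG1, Lemma 4 p.280 (bookkeeping: the residual data type)] -/
theorem nonempty_residB12Run : Nonempty (ResidB12Run P N M) :=
  ⟨{ idx := { k := 1, j := 1, one_le_j := le_rfl, j_le_k := le_rfl, cube := fun _ => 0, X := Sect2.cubeDom P M 1 fun _ => 0 },
     K := fun _ _ _ _ => 0, A₂ := fun _ _ _ _ _ => 0, A331 := Set.univ,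
     B₃ := 0, O₁ := 0, β₀ := 0, β := 0, α₀ := 0, α₁ := 0, α₂ := 0, α₃ := 0, B₃'' := 0 }⟩

end Bundle

end Literature.MathematicalPhysics.QuantumFieldTheory.Balaban1983to89.Node00

end
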